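import Summits.ResolutionOfSingularities.ResolutionOfSingularities.Theses.RuledResidues
import Literature.AlgebraicGeometry.Resolution.QuadraticSequenceDimOneExistence
import Literature.AlgebraicGeometry.Resolution.QuadraticTransformsProofs
import Literature.AlgebraicGeometry.Resolution.QuadraticTransformsUFD
import Literature.AlgebraicGeometry.Resolution.BlowupAlgebraPresentation
import Literature.AlgebraicGeometry.Resolution.DivisorialPlace

/-!
# Line `dvr-descent` for the crux `RuledResidues.RegularModelRuled` (Abhyankar's ruledness)

Line file (crux-strategist, stmt-ResolutionOfSingularities-18077) — v4: a COMPLETE, sorry-free proof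
of the crux `RegularModelRuled_of` (every former stub is proved below). The crux: a divisorial place
`W` of `K/k` (a DVR, essentially of finite type over `k`) dominating a REGULAR local ring `A_P`
of dimension `≥ 2` of an affine model `A` (`Frac A = K`) has ruled residue field `κ(W) = L(t)`.

LEVER (what replaces Abhyankar's "finiteness of the quadratic sequence along a prime divisor"):
run the sequence of quadratic transforms `R₀ = A_P → R₁ → ⋯` of `R₀` ALONG `W` inside `K`
(`quadraticSeq`, `IsQuadraticTransformAlong`). Because `W` is DISCRETE of rank one, Abhyankar's
descent (`exists_descent_sequence`: `t = yᵢ/zᵢ`, `y_{i+1} = yᵢ/xᵢ`, values strictly dropping in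
`ℕ`) shows `W = ⋃ Rᵢ` with NO dimension hypothesis (the tree's `QuadraticSequenceDimOne` used
Krull–Akizuki for this in dimension one only), and because `W = B_𝔭` is essentially of finite
type the sequence REACHES `W`: `R_c = W` (`dvrReach`, PROVED here). The members stay regular
(`isRegularLocalRing_sequence`, in tree); the last member `S = R_n ≠ W` before `W` is regular of
dimension `c + 1 ≥ 2` and its transform along `W` is `W` itself (`penultimate`, PROVED here). Then
`W = S[𝔪_S/x₀]_{(x₀)}` — the exceptional prime of the chart, `S[𝔪/x₀]/(x₀) ≅ κ(S)[X₁..X_c]`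
(`chartQuotient`, via the affine blowup algebra `blowupAlgebra 𝔪 x₀ ≅ blowupRing` and the tree's
`blowupAlgebra.comap_eval_span_algebraMap_eq`), the centre of `W` on the chart IS that exceptional
prime (`centreEqOfPrime`: a height-one prime containing a nonzero prime element, Mathlib's
`Ideal.eq_span_singleton_of_height_eq_one`) — so `κ(W) ≅ Frac κ(S)[X₁, …, X_c]`
(`exceptionalResidue`), which is ruled: `L = κ(S)(X₁..X_{c-1})`, `t = X_c` (`ratFuncRuled`, by
`MvPolynomial.finSuccEquiv` and `IsLocalization.integerNormalization`). ALL PROVED. No transcendence-degree bookkeeping ("prime divisor of `A_P`",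
dimension formula over an imperfect `k`) is needed at all.
-/

namespace Summit.ResolutionOfSingularities.ResolutionOfSingularities.Cruxes.RegularModelRuled.DvrDescent

open IsLocalRing Literature.AlgebraicGeometry.Resolution IsDiscreteValuationRing

noncomputable section

/-! ## Rational function fields in `c ≥ 1` variables are ruled (field plumbing) -/

/-- **A rational function field in `c ≥ 1` variables is ruled** (was `stub_ratFuncRuled`,
PROVED): if `E` is the field of fractions of `F[X₀, …, X_n]` through an injective `ι`, then
`E = L(t)` with `L = Frac F[X₁, …, X_n] ⊆ E` and `t = ι X₀` transcendental over `L`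
(`MvPolynomial.finSuccEquiv`; transcendence by clearing denominators with
`IsLocalization.integerNormalization`). -/
theorem ratFuncRuled (F E : Type) [Field F] [Field E] (c : ℕ) (hc : 1 ≤ c)
    (ι : MvPolynomial (Fin c) F →+* E) (hι : Function.Injective ι)
    (hfrac : ∀ z : E, ∃ p q : MvPolynomial (Fin c) F, ι q ≠ 0 ∧ z * ι q = ι p) :
    ∃ (L : Subfield E) (t : E),
      (∀ a : F, ι (MvPolynomial.C a) ∈ L) ∧
      (∀ f : Polynomial L, f ≠ 0 → Polynomial.eval₂ L.subtype t f ≠ 0) ∧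
      (∀ x : E, ∃ f g : Polynomial L, Polynomial.eval₂ L.subtype t g ≠ 0 ∧
        x * Polynomial.eval₂ L.subtype t g = Polynomial.eval₂ L.subtype t f) := by
  classical
  obtain ⟨n, rfl⟩ : ∃ n, c = n + 1 := ⟨c - 1, by omega⟩
  -- `F[X₀, …, X_n] ≅ P[Y]` with `P = F[X₁, …, X_n]`; `κ : P → F[X₀, …, X_n]`
  let φ := MvPolynomial.finSuccEquiv F n
  let κ : MvPolynomial (Fin n) F →+* MvPolynomial (Fin (n + 1)) F :=
    (φ.symm : Polynomial (MvPolynomial (Fin n) F) →+* MvPolynomial (Fin (n + 1)) F).comp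
      Polynomial.C
  let ιP : MvPolynomial (Fin n) F →+* E := ι.comp κ
  let t : E := ι (MvPolynomial.X 0)
  -- `ι ∘ φ⁻¹ = eval₂ ιP t`
  have hkey : ∀ p : Polynomial (MvPolynomial (Fin n) F),
      ι (φ.symm p) = Polynomial.eval₂ ιP t p := by
    intro p
    have h : ι.comp (φ.symm : Polynomial (MvPolynomial (Fin n) F) →+* MvPolynomial (Fin (n + 1)) F) =
        Polynomial.eval₂RingHom ιP t := by
      refine Polynomial.ringHom_ext (fun b => ?_) ?_
      · change ι (φ.symm (Polynomial.C b)) = Polynomial.eval₂ ιP t (Polynomial.C b)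
        rw [Polynomial.eval₂_C]
        rfl
      · change ι (φ.symm Polynomial.X) = Polynomial.eval₂ ιP t Polynomial.X
        rw [Polynomial.eval₂_X]
        have hX : φ.symm Polynomial.X = MvPolynomial.X 0 := by
          rw [AlgEquiv.symm_apply_eq]
          exact MvPolynomial.finSuccEquiv_X_zero.symm
        rw [hX]
    exact RingHom.congr_fun h p
  have hιP : Function.Injective ιP :=
    hι.comp (φ.symm.injective.comp Polynomial.C_injective)
  have hκC : ∀ a : F, κ (MvPolynomial.C a) = MvPolynomial.C a := fun a =>
    RingHom.congr_fun (MvPolynomial.finSuccEquiv_comp_C_eq_C (R := F) n) a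
  -- `L = Frac ιP(P) ⊆ E`
  let L : Subfield E := Subfield.closure (Set.range ιP)
  have hιPL : ∀ y, ιP y ∈ L := fun y => Subfield.subset_closure ⟨y, rfl⟩
  let ιL : MvPolynomial (Fin n) F →+* L := ιP.codRestrict L hιPL
  have hιL : L.subtype.comp ιL = ιP := RingHom.ext fun _ => rfl
  letI : Algebra (MvPolynomial (Fin n) F) L := ιL.toAlgebra
  haveI : FaithfulSMul (MvPolynomial (Fin n) F) L :=
    (faithfulSMul_iff_algebraMap_injective _ _).mpr fun a b h =>
      hιP (congrArg Subtype.val h)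
  haveI : IsFractionRing (MvPolynomial (Fin n) F) L := by
    refine IsFractionRing.of_field (R := MvPolynomial (Fin n) F) (K := L) fun z => ?_
    have hsub : Subring.closure (Set.range ιP) ≤ ιP.range :=
      Subring.closure_le.mpr (by rintro _ ⟨a, rfl⟩; exact ⟨a, rfl⟩)
    obtain ⟨y, hy, w, hw, hyw⟩ := Subfield.mem_closure_iff.mp z.2
    obtain ⟨a, rfl⟩ := hsub hy
    obtain ⟨b, rfl⟩ := hsub hw
    refine ⟨a, b, Subtype.ext ?_⟩
    exact hyw.symm
  refine ⟨L, t, fun a => ?_, fun f hf hft => ?_, fun z => ?_⟩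
  · -- constants lie in `L`
    have ha : ι (MvPolynomial.C a) = ιP (MvPolynomial.C a) := by
      change _ = ι (κ (MvPolynomial.C a))
      rw [hκC]
    rw [ha]
    exact hιPL _
  · -- `t` is transcendental over `L`: clear denominators
    set g := IsLocalization.integerNormalization (nonZeroDivisors (MvPolynomial (Fin n) F)) f
      with hg
    have hg0 : g ≠ 0 := fun h => hf (IsFractionRing.integerNormalization_eq_zero_iff.mp h)
    have hgt : Polynomial.eval₂ ιP t g = 0 := by
      have h := IsLocalization.integerNormalization_eval₂_eq_zero
        (nonZeroDivisors (MvPolynomial (Fin n) F)) L.subtype f hft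
      rwa [show L.subtype.comp (algebraMap (MvPolynomial (Fin n) F) L) = ιP from hιL] at h
    apply hg0
    apply φ.symm.injective
    rw [map_zero]
    apply hι
    rw [map_zero, hkey, hgt]
  · -- `E = L(t)`
    obtain ⟨p, q, hq, hzq⟩ := hfrac z
    refine ⟨(φ p).map ιL, (φ q).map ιL, ?_, ?_⟩
    · rw [Polynomial.eval₂_map, hιL, ← hkey, AlgEquiv.symm_apply_apply]
      exact hq
    · rw [Polynomial.eval₂_map, Polynomial.eval₂_map, hιL, ← hkey, ← hkey,
        AlgEquiv.symm_apply_apply, AlgEquiv.symm_apply_apply]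
      exact hzq

/-! ## Proved: DVR reach (Abhyankar's descent + discreteness; no dimension hypothesis) -/

/-- In a discrete valuation ring `O ⊆ K` there is no sequence of nonzero elements of `O` whose
values strictly increase (towards `1`): the additive valuations would strictly decrease in `ℕ`. -/
theorem not_strictMono_valuation_of_isDiscreteValuationRing {K : Type} [Field K]
    (O : ValuationSubring K) [IsDiscreteValuationRing O] (y : ℕ → K) (hyO : ∀ i, y i ∈ O)
    (hy0 : ∀ i, y i ≠ 0) (hmono : ∀ i, O.valuation (y i) < O.valuation (y (i + 1))) : False := by
  classical
  set a : ℕ → O := fun i => ⟨y i, hyO i⟩ with ha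
  have ha0 : ∀ i, a i ≠ 0 := fun i h => hy0 i (congrArg Subtype.val h)
  have hfin : ∀ i, addVal O (a i) ≠ ⊤ := fun i h => ha0 i (addVal_eq_top_iff.mp h)
  -- one step: `a i = b * a (i+1)` with `b` a non-unit, so the additive valuation drops by `≥ 1`
  have hstep : ∀ i, addVal O (a (i + 1)) + 1 ≤ addVal O (a i) := by
    intro i
    obtain ⟨b, hb⟩ := (O.valuation_le_iff (y i) (y (i + 1))).mp (hmono i).le
    have hab : a i = b * a (i + 1) := Subtype.ext (by simpa [ha] using hb.symm)
    have hbu : ¬ IsUnit b := by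
      intro hu
      have hvb : O.valuation (b : K) = 1 := (O.valuation_eq_one_iff b).mp hu
      have : O.valuation (y i) = O.valuation (y (i + 1)) := by
        rw [← hb, map_mul, hvb, one_mul]
      exact (hmono i).ne this
    have hb1 : 1 ≤ addVal O b :=
      Order.one_le_iff_ne_zero.mpr fun h => hbu (addVal_eq_zero_iff.mp h)
    rw [hab, addVal_mul, add_comm (addVal O b)]
    exact add_le_add_right hb1 _
  have key : ∀ i : ℕ, addVal O (a i) + i ≤ addVal O (a 0) := by
    intro i
    induction i with
    | zero => simp
    | succ i ih =>
      calc addVal O (a (i + 1)) + ((i + 1 : ℕ) : ℕ∞)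
          = (addVal O (a (i + 1)) + 1) + i := by push_cast; ring
        _ ≤ addVal O (a i) + i := add_le_add_left (hstep i) _
        _ ≤ addVal O (a 0) := ih
  obtain ⟨m, hm⟩ := ENat.ne_top_iff_exists.mp (hfin 0)
  have h1 := key (m + 1)
  rw [← hm] at h1
  have h2 : ((m + 1 : ℕ) : ℕ∞) ≤ (m : ℕ∞) := le_trans le_add_self h1
  have h3 : m + 1 ≤ m := by exact_mod_cast h2
  omega

section DvrReach

variable {K : Type} [Field K] {O : ValuationSubring K} {A : ℕ → Subring K}

/-- **`O = ⋃ Aᵢ` for the quadratic sequence of a local ring of `K` along a DISCRETE valuation ring**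
(Abhyankar's descent, no dimension hypothesis). -/
theorem mem_sequence_of_mem_of_isDiscreteValuationRing [IsDiscreteValuationRing O]
    (hof : IsLocalRingOf (A 0)) (h0 : SubringDominates (A 0) O.toSubring)
    (hstep : ∀ i, IsQuadraticTransformAlong O (A i) (A (i + 1))) {t : K} (ht : t ∈ O) :
    ∃ i, t ∈ A i := by
  classical
  by_contra hcon
  rw [not_exists] at hcon
  have ht' : ∀ i, t⁻¹ ∉ A i := fun i hti => hcon i (mem_sequence_of_inv_mem h0 hstep ht hti)
  have hdomO : ∀ i, SubringDominates (A i) O.toSubring := fun i => (sequence_dominates h0 hstep i).1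
  obtain ⟨y₀, hy₀, z₀, hz₀, -, htyz⟩ := hof.2 t
  obtain ⟨y, x, hy0, hyR, hx, hysucc⟩ := exists_descent_sequence hstep hcon ht' hy₀ hz₀ htyz
  have ht0 : t ≠ 0 := fun h => hcon 0 (h ▸ (A 0).zero_mem)
  have hy_ne : ∀ i, y i ≠ 0 := by
    intro i
    induction i with
    | zero =>
      rw [hy0]
      rintro rfl
      rw [zero_div] at htyz
      exact ht0 htyz
    | succ i ih => rw [hysucc]; exact div_ne_zero ih (hx i).2.1
  have hmono : ∀ i, O.valuation (y i) < O.valuation (y (i + 1)) := by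
    intro i
    obtain ⟨hxi, hxi0, hxiinv⟩ := hx i
    have hvx : O.valuation (x i) < 1 := valuation_lt_one_of_subringDominates (hdomO i) hxi hxiinv
    have hvx0 : O.valuation (x i) ≠ 0 := (_root_.map_ne_zero _).mpr hxi0
    have hvy0 : O.valuation (y i) ≠ 0 := (_root_.map_ne_zero _).mpr (hy_ne i)
    rw [hysucc, map_div₀, lt_div_iff₀ (pos_iff_ne_zero.mpr hvx0)]
    have := mul_lt_mul_of_lt_of_le_of_nonneg_of_pos hvx (le_refl (O.valuation (y i))) zero_le
      (pos_iff_ne_zero.mpr hvy0)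
    rwa [one_mul, mul_comm] at this
  exact not_strictMono_valuation_of_isDiscreteValuationRing O y
    (fun i => (hdomO i).1 (hyR i)) hy_ne hmono

/-- A finite subset of the DVR `O` lies in some member of the sequence. -/
theorem exists_finset_subset_sequence_of_isDiscreteValuationRing [IsDiscreteValuationRing O]
    (hof : IsLocalRingOf (A 0)) (h0 : SubringDominates (A 0) O.toSubring)
    (hstep : ∀ i, IsQuadraticTransformAlong O (A i) (A (i + 1))) (S : Finset K)
    (hS : (S : Set K) ⊆ O) : ∃ c, (S : Set K) ⊆ A c := by
  classical
  have hmono : Monotone A := sequence_monotone hstep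
  induction S using Finset.induction_on with
  | empty => exact ⟨0, by simp⟩
  | insert a S haS ih =>
    rw [Finset.coe_insert] at hS
    obtain ⟨c₁, hc₁⟩ := ih ((Set.subset_insert _ _).trans hS)
    obtain ⟨c₂, hc₂⟩ := mem_sequence_of_mem_of_isDiscreteValuationRing hof h0 hstep
      (hS (Set.mem_insert _ _))
    refine ⟨max c₁ c₂, ?_⟩
    rw [Finset.coe_insert, Set.insert_subset_iff]
    exact ⟨hmono (le_max_right _ _) hc₂, hc₁.trans (hmono (le_max_left _ _))⟩

/-- **DVR reach** (was `stub_dvrReach`): the quadratic sequence of a local ring of `K` along a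
discrete valuation ring `O` essentially of finite type over it reaches `O`. -/
theorem dvrReach (O : ValuationSubring K) [IsDiscreteValuationRing O]
    (R : ℕ → Subring K) (hof : IsLocalRingOf (R 0)) (h0 : SubringDominates (R 0) O.toSubring)
    (hstep : ∀ i, IsQuadraticTransformAlong O (R i) (R (i + 1)))
    {N : Subring K} (hNO : N ≤ O.toSubring) (S : Finset K) (hSN : (S : Set K) ⊆ N)
    (hNS : N ≤ Subring.closure ((R 0 : Set K) ∪ ↑S))
    (hON : O.toSubring ≤ locAtCentre N O) :
    ∃ c, R c = O.toSubring := by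
  classical
  have hSO : (S : Set K) ⊆ O := fun s hs => hNO (hSN hs)
  obtain ⟨c, hc⟩ := exists_finset_subset_sequence_of_isDiscreteValuationRing hof h0 hstep S hSO
  have hmono : Monotone R := sequence_monotone hstep
  have hNA : N ≤ R c := by
    refine hNS.trans (Subring.closure_le.mpr ?_)
    rintro z (hz | hz)
    · exact hmono (Nat.zero_le c) hz
    · exact hc hz
  have hdom : SubringDominates (R c) O.toSubring := (sequence_dominates h0 hstep c).1
  refine ⟨c, le_antisymm hdom.1 ?_⟩
  intro z hz
  obtain ⟨y, hy, w, hw, hvw, rfl⟩ := (mem_locAtCentre_iff).mp (hON hz)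
  have hwinv : w⁻¹ ∈ O := by
    rw [← O.valuation_le_one_iff, map_inv₀, hvw, inv_one]
  have hwinvA : w⁻¹ ∈ R c := hdom.2 w (hNA hw) hwinv
  rw [div_eq_mul_inv]
  exact (R c).mul_mem (hNA hy) hwinvA

end DvrReach

/-! ## Proved: the penultimate ring -/

section Penultimate

variable {K : Type} [Field K]

/-- A regular local subring of `K` of dimension `≤ 1` with fraction field `K`, dominated by the
valuation ring `O`, is `O` (it is a valuation ring of `K` — a field or a DVR — dominated by `O`). -/
theorem eq_of_isRegularLocalRing_of_ringKrullDim_le_one {O : ValuationSubring K} {S : Subring K}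
    (hreg : IsRegularLocalRing S) (hdim : ringKrullDim S ≤ 1)
    (hof : ∀ z : K, ∃ a ∈ S, ∃ b ∈ S, b ≠ 0 ∧ z = a / b) (hdom : SubringDominates S O.toSubring) :
    S = O.toSubring := by
  haveI : IsPrincipalIdealRing S := isPrincipalIdealRing_of_ringKrullDim_le_one hdim
  haveI : ValuationRing S :=
    (ValuationRing.iff_local_bezout_domain (R := S)).mpr ⟨inferInstance, inferInstance⟩
  haveI : IsFractionRing S K := isFractionRing_of_isLocalRingOf_le hof le_rfl
  refine le_antisymm hdom.1 fun z hz => ?_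
  rcases ValuationRing.isInteger_or_isInteger S z with ⟨a, ha⟩ | ⟨a, ha⟩
  · rw [← ha]; exact a.2
  · have hinv : z⁻¹ ∈ S := by rw [← ha]; exact a.2
    have h := hdom.2 z⁻¹ hinv (by rw [inv_inv]; exact hz)
    rwa [inv_inv] at h

/-- For a regular local ring, `¬ (dim ≤ 1)` means `2 ≤ dim` (the dimension is a natural number). -/
theorem two_le_ringKrullDim_of_not_le_one {S : Type} [CommRing S] [IsRegularLocalRing S]
    (h : ¬ ringKrullDim S ≤ 1) : (2 : WithBot ℕ∞) ≤ ringKrullDim S := by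
  have h1 := (isRegularLocalRing_iff S).mp ‹_›
  rw [← h1] at h ⊢
  have h2 : ¬ (maximalIdeal S).spanFinrank ≤ 1 := fun h' => h (by exact_mod_cast h')
  have h3 : 2 ≤ (maximalIdeal S).spanFinrank := by omega
  exact_mod_cast h3

/-- **The penultimate ring** (was `stub_penultimate`, PROVED): if the sequence from a regular `R₀`
of dimension `≥ 2` reaches the DVR `O`, some `R_n` is regular of dimension `≥ 2` with `R_{n+1} = O`. -/
theorem penultimate (O : ValuationSubring K) [IsDiscreteValuationRing O]
    (R : ℕ → Subring K) (hreg : IsRegularLocalRing (R 0))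
    (hdim : (2 : WithBot ℕ∞) ≤ ringKrullDim (R 0)) (hof : IsLocalRingOf (R 0))
    (h0 : SubringDominates (R 0) O.toSubring)
    (hstep : ∀ i, IsQuadraticTransformAlong O (R i) (R (i + 1))) (hc : ∃ c, R c = O.toSubring) :
    ∃ n, IsRegularLocalRing (R n) ∧ (2 : WithBot ℕ∞) ≤ ringKrullDim (R n) ∧
      R (n + 1) = O.toSubring := by
  classical
  have hregi : ∀ i, IsRegularLocalRing (R i) := isRegularLocalRing_sequence hreg hstep
  have hdomO : ∀ i, SubringDominates (R i) O.toSubring := fun i => (sequence_dominates h0 hstep i).1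
  have hmono : Monotone R := sequence_monotone hstep
  -- a member equal to `O` has dimension `1`
  have hdim_of_eq : ∀ i, R i = O.toSubring → ringKrullDim (R i) = 1 := by
    intro i hi
    rw [ringKrullDim_eq_of_ringEquiv (RingEquiv.subringCongr hi)]
    exact IsDiscreteValuationRing.ringKrullDim_eq_one O
  -- minimal index with `R m = O`; it is positive
  have hRm : R (Nat.find hc) = O.toSubring := Nat.find_spec hc
  have hm0 : Nat.find hc ≠ 0 := by
    intro h0m
    have h1 := hdim_of_eq 0 (by rw [← h0m]; exact hRm)
    rw [h1] at hdim
    exact absurd hdim (by decide)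
  obtain ⟨n, hn⟩ := Nat.exists_eq_succ_of_ne_zero hm0
  have hRn : R n ≠ O.toSubring := Nat.find_min hc (by rw [hn]; exact Nat.lt_succ_self n)
  rw [hn] at hRm
  refine ⟨n, hregi n, ?_, hRm⟩
  -- `R n` is not of dimension `≤ 1`: it would be a valuation ring of `K` dominated by `O`, i.e. `O`
  haveI := hregi n
  refine two_le_ringKrullDim_of_not_le_one fun hle => hRn ?_
  have hofn : ∀ z : K, ∃ a ∈ R n, ∃ b ∈ R n, b ≠ 0 ∧ z = a / b := fun z => by
    obtain ⟨a, ha, b, hb, hb0, rfl⟩ := hof.2 z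
    exact ⟨a, hmono (Nat.zero_le n) ha, b, hmono (Nat.zero_le n) hb, hb0, rfl⟩
  exact eq_of_isRegularLocalRing_of_ringKrullDim_le_one (hregi n) hle hofn (hdomO n)

end Penultimate

/-! ## The exceptional prime and its residue field -/

section Exceptional

variable {K : Type} [Field K]

local notation3 "𝓐[" x "," i "]" => blowupAlgebra (Ideal.span (Set.range x)) (x i)

/-- **The centre of a DVR on a model is any nonzero principal prime it contains** (was stub A,
PROVED). Let `B ⊆ O` be a subring of `K` with `O = B_{𝔪_O ∩ B}` a discrete valuation ring, and
`p ∈ B` nonzero of positive value with `p B` prime. Then every element of `B` of positive value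
is a multiple of `p` in `B`: the centre `𝔮 = 𝔪_O ∩ B` has height `dim O = 1`
(`IsLocalization.AtPrime.ringKrullDim_eq_height`) and contains the prime element `p`, so
`𝔮 = p B` (`Ideal.eq_span_singleton_of_height_eq_one`). -/
theorem centreEqOfPrime (O : ValuationSubring K) [IsDiscreteValuationRing O]
    (B : Subring K) (hBO : B ≤ O.toSubring)
    (hO : O.toSubring = locAtCentre B O) {p : K} (hpB : p ∈ B) (hp0 : p ≠ 0)
    (hvp : O.valuation p < 1) (hprime : (Ideal.span {(⟨p, hpB⟩ : B)}).IsPrime) :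
    ∀ z ∈ B, O.valuation z < 1 → ∃ w ∈ B, z = w * p := by
  intro z hz hvz
  haveI := isLocalization_locAtCentre hBO
  -- the centre has height `dim O = 1`
  have hdimloc : ringKrullDim (locAtCentre B O) = 1 := by
    rw [ringKrullDim_eq_of_ringEquiv (RingEquiv.subringCongr hO.symm)]
    exact IsDiscreteValuationRing.ringKrullDim_eq_one O
  have hht : (subringCentre B O hBO).height = 1 := by
    have h := IsLocalization.AtPrime.ringKrullDim_eq_height (subringCentre B O hBO) (locAtCentre B O)
    rw [hdimloc] at h
    exact_mod_cast h.symm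
  -- `p` is a prime element of the centre
  have hpB0 : (⟨p, hpB⟩ : B) ≠ 0 := fun h => hp0 (congrArg Subtype.val h)
  have hprimeElt : Prime (⟨p, hpB⟩ : B) := (Ideal.span_singleton_prime hpB0).mp hprime
  have hpq : (⟨p, hpB⟩ : B) ∈ subringCentre B O hBO := (mem_subringCentre_iff hBO _).mpr hvp
  have heq : subringCentre B O hBO = Ideal.span {(⟨p, hpB⟩ : B)} :=
    Ideal.eq_span_singleton_of_height_eq_one hht hpq hprimeElt
  have hzq : (⟨z, hz⟩ : B) ∈ subringCentre B O hBO := (mem_subringCentre_iff hBO _).mpr hvz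
  rw [heq, Ideal.mem_span_singleton'] at hzq
  obtain ⟨w, hw⟩ := hzq
  refine ⟨w, w.2, ?_⟩
  have := congrArg Subtype.val hw
  simpa [Subring.coe_mul] using this.symm

/-- **The exceptional fibre of the chart is an affine space** (was stub B, PROVED; Stacks 0BIQ
for the regular system of parameters `x` of the regular local ring `S ⊆ K`):
`S[𝔪/x_i]/(x_i) ≅ κ(S)[T_j : j ≠ i]`, compatibly with `S → S[𝔪/x_i]`. The affine blowup algebra
`S[𝔪/x_i] ⊆ S[1/x_i]` (`blowupAlgebra`) maps isomorphically onto `blowupRing S x_i ⊆ K` under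
`S[1/x_i] → K`; modulo `x_i` its presentation `S[T_j : j ≠ i] → S[𝔪/x_i]` has kernel `𝔪 · S[T]`
(`blowupAlgebra.comap_eval_span_algebraMap_eq`, quasi-regularity of `x`), which is the kernel of
`S[T] → κ(S)[T]`. -/
theorem chartQuotient (S : Subring K) [IsRegularLocalRing S] {d : ℕ}
    (hd : (maximalIdeal S).spanFinrank = d) (x : Fin d → S)
    (hx : Ideal.span (Set.range x) = maximalIdeal S) (i : Fin d) (hxi : x i ≠ 0) :
    ∃ ψ : MvPolynomial {j : Fin d // j ≠ i} (ResidueField S) →+*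
        blowupRing S (x i : K) ⧸
          Ideal.span {(⟨(x i : K), le_blowupRing S (x i : K) (x i).2⟩ : blowupRing S (x i : K))},
      Function.Bijective ψ ∧
      ∀ s : S, ψ (MvPolynomial.C (residue S s)) =
        Ideal.Quotient.mk _ ⟨(s : K), le_blowupRing S (x i : K) s.2⟩ := by
  classical
  have hxm : ∀ j, x j ∈ maximalIdeal S := fun j => hx ▸ Ideal.subset_span ⟨j, rfl⟩
  have hθ : ((x i : S) : K) ≠ 0 := fun h => hxi (Subtype.ext h)
  have hunit : IsUnit (S.subtype (x i)) := isUnit_iff_ne_zero.mpr hθ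
  -- `Θ : S[1/x_i] → K` and `g : S[𝔪/x_i] → K`
  let Θ : Localization.Away (x i) →+* K := IsLocalization.Away.lift (x i) hunit
  have hΘalg : ∀ s : S, Θ (algebraMap S (Localization.Away (x i)) s) = (s : K) := fun s =>
    IsLocalization.Away.lift_eq (x i) hunit s
  have hΘinv : Θ (IsLocalization.Away.invSelf (x i)) = ((x i : S) : K)⁻¹ := by
    apply eq_inv_of_mul_eq_one_left
    rw [← hΘalg (x i), ← map_mul, mul_comm, IsLocalization.Away.mul_invSelf, map_one]
  let g : 𝓐[x, i] →+* K := Θ.comp (𝓐[x, i]).val.toRingHom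
  have hgalg : ∀ s : S, g (algebraMap S 𝓐[x, i] s) = (s : K) := fun s => hΘalg s
  have hgfrac : ∀ j : Fin d, g (blowupAlgebra.frac x i j) = ((x j : S) : K) / ((x i : S) : K) := by
    intro j
    change Θ ((blowupAlgebra.frac x i j : Localization.Away (x i))) = _
    rw [blowupAlgebra.coe_frac, map_mul, hΘalg, hΘinv, div_eq_mul_inv]
  -- `g ∘ eval = eval₂ (x_j/x_i)`
  have hgeval : g.comp (blowupAlgebra.eval x i).toRingHom =
      MvPolynomial.eval₂Hom S.subtype
        (fun j : {j : Fin d // j ≠ i} => ((x j.1 : S) : K) / ((x i : S) : K)) := by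
    refine (blowupAlgebra.comp_val_comp_eval x i Θ).trans ?_
    congr 1
    · ext s
      exact hΘalg s
    · funext j
      exact hgfrac j.1
  have hgeval' : ∀ P, g (blowupAlgebra.eval x i P) = MvPolynomial.eval₂Hom S.subtype
      (fun j : {j : Fin d // j ≠ i} => ((x j.1 : S) : K) / ((x i : S) : K)) P := fun P => by
    rw [← hgeval]; rfl
  -- the range of `g` is `S[𝔪/x_i] ⊆ K`
  have heval_mem : ∀ P : MvPolynomial {j : Fin d // j ≠ i} S, MvPolynomial.eval₂Hom S.subtype
      (fun j : {j : Fin d // j ≠ i} => ((x j.1 : S) : K) / ((x i : S) : K)) P ∈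
        blowupRing S (x i : K) := by
    intro P
    induction P using MvPolynomial.induction_on with
    | C s =>
      rw [MvPolynomial.eval₂Hom_C]
      exact le_blowupRing S _ s.2
    | add p q hp hq =>
      rw [map_add]
      exact Subring.add_mem _ hp hq
    | mul_X p j hp =>
      rw [map_mul, MvPolynomial.eval₂Hom_X']
      exact Subring.mul_mem _ hp (div_mem_blowupRing _ (hxm j.1))
  have hrange : g.range = blowupRing S (x i : K) := by
    apply le_antisymm
    · rintro _ ⟨z, rfl⟩
      obtain ⟨P, rfl⟩ := blowupAlgebra.eval_surjective x i z
      rw [hgeval']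
      exact heval_mem P
    · rw [blowupRing_eq_closure_of_span_eq ((x i : S) : K) (Set.range x) hx, Subring.closure_le]
      rintro z (hz | ⟨y, ⟨j, rfl⟩, rfl⟩)
      · exact ⟨algebraMap S _ ⟨z, hz⟩, hgalg ⟨z, hz⟩⟩
      · exact ⟨blowupAlgebra.frac x i j, hgfrac j⟩
  -- `g` is injective
  have hΘinj : ∀ z, Θ z = 0 → z = 0 := by
    intro z hz
    obtain ⟨⟨r, s⟩, hrs⟩ := IsLocalization.surj (Submonoid.powers (x i)) z
    have hr : (r : K) = 0 := by
      have h := congrArg Θ hrs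
      rw [map_mul, hz, zero_mul, hΘalg] at h
      exact h.symm
    have hr0 : r = 0 := Subtype.ext hr
    rw [hr0, map_zero] at hrs
    exact (IsUnit.mul_left_eq_zero (IsLocalization.map_units _ s)).mp hrs
  have hginj : Function.Injective g := by
    intro a b h
    apply Subtype.ext
    have h0 : Θ ((a : Localization.Away (x i)) - b) = 0 := by
      rw [map_sub]
      exact sub_eq_zero.mpr h
    exact sub_eq_zero.mp (hΘinj _ h0)
  -- `e₁ : S[𝔪/x_i] ≃ blowupRing S x_i`
  have hmem : ∀ b, g b ∈ blowupRing S (x i : K) := fun b => by rw [← hrange]; exact ⟨b, rfl⟩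
  let g' : 𝓐[x, i] →+* blowupRing S (x i : K) := g.codRestrict _ hmem
  have hg' : Function.Bijective g' := by
    refine ⟨fun a b h => hginj (congrArg Subtype.val h), fun z => ?_⟩
    have hz : (z : K) ∈ g.range := by rw [hrange]; exact z.2
    obtain ⟨b, hb⟩ := hz
    exact ⟨b, Subtype.ext hb⟩
  let e₁ : 𝓐[x, i] ≃+* blowupRing S (x i : K) := RingEquiv.ofBijective g' hg'
  have he₁alg : ∀ s : S, e₁ (algebraMap S 𝓐[x, i] s) = ⟨(s : K), le_blowupRing S (x i : K) s.2⟩ :=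
    fun s => Subtype.ext (hgalg s)
  -- the presentation modulo `x_i`: `S[T] → S[𝔪/x_i]/(x_i)` is onto with kernel `𝔪 · S[T]`
  let J : Ideal 𝓐[x, i] := Ideal.span {algebraMap S 𝓐[x, i] (x i)}
  let π : MvPolynomial {j : Fin d // j ≠ i} S →+* 𝓐[x, i] ⧸ J :=
    (Ideal.Quotient.mk J).comp (blowupAlgebra.eval x i).toRingHom
  have hπsurj : Function.Surjective π :=
    Ideal.Quotient.mk_surjective.comp (blowupAlgebra.eval_surjective x i)
  have hπker : RingHom.ker π = Ideal.map MvPolynomial.C (Ideal.span (Set.range x)) := by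
    change RingHom.ker ((Ideal.Quotient.mk J).comp _) = _
    rw [← RingHom.comap_ker, Ideal.mk_ker]
    exact blowupAlgebra.comap_eval_span_algebraMap_eq x i
      (isQuasiRegular_regularSystemOfParameters hd x hx)
  -- `S[T] → κ(S)[T]` is onto with the same kernel
  let σ : MvPolynomial {j : Fin d // j ≠ i} S →+* MvPolynomial {j : Fin d // j ≠ i} (ResidueField S) :=
    MvPolynomial.map (residue S)
  have hσsurj : Function.Surjective σ := MvPolynomial.map_surjective _ residue_surjective
  have hσker : RingHom.ker σ = Ideal.map MvPolynomial.C (Ideal.span (Set.range x)) := by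
    change RingHom.ker (MvPolynomial.map (residue S)) = _
    rw [MvPolynomial.ker_map, ker_residue, hx]
  -- hence `ψ' : κ(S)[T] → S[𝔪/x_i]/(x_i)`, a bijection
  let ψ' : MvPolynomial {j : Fin d // j ≠ i} (ResidueField S) →+* 𝓐[x, i] ⧸ J :=
    σ.liftOfSurjective hσsurj ⟨π, by rw [hσker, hπker]⟩
  have hψ'σ : ∀ P, ψ' (σ P) = π P := fun P =>
    σ.liftOfSurjective_comp_apply hσsurj ⟨π, by rw [hσker, hπker]⟩ P
  have hψ'bij : Function.Bijective ψ' := by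
    constructor
    · refine (injective_iff_map_eq_zero ψ').mpr fun Q hQ => ?_
      obtain ⟨P, rfl⟩ := hσsurj Q
      rw [hψ'σ] at hQ
      have hP : P ∈ RingHom.ker σ := by rw [hσker, ← hπker]; exact hQ
      exact hP
    · intro z
      obtain ⟨P, rfl⟩ := hπsurj z
      exact ⟨σ P, hψ'σ P⟩
  -- transport `S[𝔪/x_i]/(x_i) ≅ blowupRing/(x_i)` along `e₁`
  let J' : Ideal (blowupRing S (x i : K)) :=
    Ideal.span {(⟨(x i : K), le_blowupRing S (x i : K) (x i).2⟩ : blowupRing S (x i : K))}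
  have hJJ' : J' = J.map (e₁ : 𝓐[x, i] →+* blowupRing S (x i : K)) := by
    change Ideal.span _ = Ideal.map _ (Ideal.span _)
    rw [Ideal.map_span, Set.image_singleton]
    congr 2
    exact (he₁alg (x i)).symm
  let q : 𝓐[x, i] ⧸ J ≃+* blowupRing S (x i : K) ⧸ J' := Ideal.quotientEquiv J J' e₁ hJJ'
  refine ⟨q.toRingHom.comp ψ', q.bijective.comp hψ'bij, fun s => ?_⟩
  -- constants: `C s̄ ↦ [s/1] ↦ [s]`
  have hσC : σ (MvPolynomial.C s) = MvPolynomial.C (residue S s) := MvPolynomial.map_C _ _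
  change q (ψ' (MvPolynomial.C (residue S s))) = _
  rw [← hσC, hψ'σ]
  change q (Ideal.Quotient.mk J ((blowupAlgebra.eval x i) (MvPolynomial.C s))) = _
  rw [blowupAlgebra.eval_C, Ideal.quotientEquiv_mk]
  congr 1
  exact he₁alg s

/-- **Residue field of the exceptional prime** (PROVED, from `centreEqOfPrime` and `chartQuotient`): for a regular local ring `S ⊆ K` of dimension `c + 1 ≥ 2` DOMINATED by the DVR
`O` and whose quadratic transform along `O` is `O` itself, `κ(O)` is the fraction field of
`κ(S)[X₁, …, X_c]` through an injective `ι` compatible with `S → O`. -/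
theorem exceptionalResidue (O : ValuationSubring K) [IsDiscreteValuationRing O] (S : Subring K)
    (hreg : IsRegularLocalRing S) (hdim : (2 : WithBot ℕ∞) ≤ ringKrullDim S)
    (hdom : SubringDominates S O.toSubring) (hS : IsQuadraticTransformAlong O S O.toSubring) :
    ∃ (c : ℕ) (_ : 1 ≤ c) (ι : MvPolynomial (Fin c) (ResidueField S) →+* ResidueField O),
      Function.Injective ι ∧
      (∀ z : ResidueField O, ∃ p q : MvPolynomial (Fin c) (ResidueField S),
        ι q ≠ 0 ∧ z * ι q = ι p) ∧
      ∀ s : S, ι (MvPolynomial.C (residue S s)) = residue O ⟨(s : K), hS.source_le s.2⟩ := by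
  classical
  have hSO := hS.source_le
  -- a regular system of parameters; the dimension is `d ≥ 2`
  obtain ⟨x, hx⟩ := exists_regularSystemOfParameters (R := S)
  have h2d : 2 ≤ (maximalIdeal S).spanFinrank := by
    have h1 := (isRegularLocalRing_iff S).mp hreg
    rw [← h1] at hdim
    exact_mod_cast hdim
  haveI : Nontrivial (Fin (maximalIdeal S).spanFinrank) := Fin.nontrivial_iff_two_le.mpr h2d
  -- the parameters are nonzero non-units, of positive value
  have hx0 : ∀ j, x j ≠ 0 := by
    intro j h
    have := not_mem_span_image_of_not_mem rfl x hx (S := ∅) (i := j) (Set.notMem_empty j)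
    rw [Set.image_empty, Ideal.span_empty, h] at this
    exact this (Submodule.zero_mem ⊥)
  have hx0' : ∀ j, ((x j : S) : K) ≠ 0 := fun j h => hx0 j (Subtype.ext h)
  have hxm : ∀ j, x j ∈ maximalIdeal S := fun j => hx ▸ Ideal.subset_span ⟨j, rfl⟩
  have hvx : ∀ j, O.valuation ((x j : S) : K) < 1 := fun j =>
    valuation_lt_one_of_subringDominates hdom (x j).2 fun hinv =>
      ((mem_maximalIdeal_iff_inv_not_mem (x j)).mp (hxm j)).elim (fun h0 => hx0' j h0)
        (fun h => h hinv)
  -- a parameter of minimal value and the transform along `O` in its chart (as in the tree)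
  obtain ⟨j₀, -, -⟩ := exists_pair_ne (Fin (maximalIdeal S).spanFinrank)
  obtain ⟨i, -, hi0, hmax⟩ := exists_max_valuation O Finset.univ (fun j => ((x j : S) : K))
    ⟨j₀, Finset.mem_univ _, hx0' j₀⟩
  have hspan : Ideal.span (↑(Finset.univ.image x) : Set S) = maximalIdeal S := by
    rw [Finset.coe_image, Finset.coe_univ, Set.image_univ, hx]
  haveI : IsLocalRing S := hreg.toIsLocalRing
  have h' : IsQuadraticTransformAlong O S (locAtCentre (blowupRing S (x i : K)) O) := by
    refine ⟨‹_›, hSO, Finset.univ.image x, x i, hspan, Finset.mem_image_of_mem x (Finset.mem_univ i),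
      hx0 i, ?_, ?_⟩
    · intro y hy
      obtain ⟨j, -, rfl⟩ := Finset.mem_image.mp hy
      exact hmax j (Finset.mem_univ j)
    · rw [blowupRing_eq_closure_of_span_eq (x i : K) _ hspan]
  have hO : O.toSubring = locAtCentre (blowupRing S (x i : K)) O := hS.unique h'
  set B : Subring K := blowupRing S (x i : K) with hB
  have hBO : B ≤ O.toSubring := by rw [hO]; exact le_locAtCentre B O
  haveI : IsRegularRing B := isRegularRing_blowupRing S rfl x hx i
  -- stub B: the exceptional fibre, and primality of `(x_i)`
  obtain ⟨ψ, hψ, hψC⟩ := chartQuotient (K := K) S rfl x hx i (hx0 i)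
  let pB : B := ⟨(x i : K), le_blowupRing S (x i : K) (x i).2⟩
  haveI hprime : (Ideal.span {pB}).IsPrime := by
    rw [← Ideal.Quotient.isDomain_iff_prime]
    exact MulEquiv.isDomain (MvPolynomial {j // j ≠ i} (ResidueField S))
      (RingEquiv.ofBijective ψ hψ).symm.toMulEquiv
  -- stub A: the centre of `O` on `B` is `(x_i)`
  have hcentre := centreEqOfPrime O B hBO hO (le_blowupRing S (x i : K) (x i).2) (hx0' i)
    (hvx i) hprime
  -- the residue map `r : B → κ(O)` and its kernel
  let incl : B →+* O := Subring.inclusion hBO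
  let r : B →+* ResidueField O := (residue O).comp incl
  have hr_zero : ∀ b : B, r b = 0 ↔ O.valuation (b : K) < 1 := fun b => by
    change residue O (incl b) = 0 ↔ _
    rw [residue_eq_zero_iff, ValuationSubring.valuation_lt_one_iff]
    rfl
  have hker : ∀ b : B, r b = 0 ↔ b ∈ Ideal.span {pB} := fun b => by
    rw [hr_zero, Ideal.mem_span_singleton']
    constructor
    · intro hv
      obtain ⟨w, hw, hbw⟩ := hcentre b b.2 hv
      exact ⟨⟨w, hw⟩, Subtype.ext hbw.symm⟩
    · rintro ⟨a, ha⟩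
      have hb : (b : K) = (a : K) * (x i : K) := by rw [← ha]; rfl
      rw [hb, map_mul]
      calc O.valuation (a : K) * O.valuation ((x i : S) : K)
          ≤ 1 * O.valuation ((x i : S) : K) :=
            mul_le_mul_left ((O.valuation_le_one_iff _).mpr (hBO a.2)) _
        _ = O.valuation ((x i : S) : K) := one_mul _
        _ < 1 := hvx i
  let rbar : B ⧸ Ideal.span {pB} →+* ResidueField O :=
    Ideal.Quotient.lift _ r (fun b hb => (hker b).mpr hb)
  have hrbar : Function.Injective rbar :=
    RingHom.lift_injective_of_ker_le_ideal _ (fun b hb => (hker b).mpr hb)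
      (fun b hb => (hker b).mp hb)
  -- reindex the variables by `Fin c`, `c = d - 1 ≥ 1`
  obtain ⟨j₁, hj₁⟩ := exists_ne i
  set c := Fintype.card {j : Fin (maximalIdeal S).spanFinrank // j ≠ i} with hc
  have h1c : 1 ≤ c := Fintype.card_pos_iff.mpr ⟨⟨j₁, hj₁⟩⟩
  let e : {j : Fin (maximalIdeal S).spanFinrank // j ≠ i} ≃ Fin c := Fintype.equivFin _
  let ρ : MvPolynomial (Fin c) (ResidueField S) →+*
      MvPolynomial {j : Fin (maximalIdeal S).spanFinrank // j ≠ i} (ResidueField S) :=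
    (MvPolynomial.renameEquiv (ResidueField S) e.symm).toRingEquiv.toRingHom
  have hρ : Function.Bijective ρ := (MvPolynomial.renameEquiv (ResidueField S) e.symm).bijective
  have hψρ_inj : Function.Injective (ψ.comp ρ) := hψ.1.comp hρ.1
  have hsurj : Function.Surjective (ψ.comp ρ) := hψ.2.comp hρ.2
  refine ⟨c, h1c, rbar.comp (ψ.comp ρ), hrbar.comp hψρ_inj, ?_, ?_⟩
  · intro z
    obtain ⟨z', rfl⟩ := IsLocalRing.residue_surjective z
    have hz' : (z' : K) ∈ locAtCentre B O := by rw [← hO]; exact z'.2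
    obtain ⟨y, hy, w, hw, hvw, hzyw⟩ := hz'
    obtain ⟨p, hp⟩ := hsurj (Ideal.Quotient.mk _ ⟨y, hy⟩)
    obtain ⟨q, hq⟩ := hsurj (Ideal.Quotient.mk _ ⟨w, hw⟩)
    refine ⟨p, q, ?_, ?_⟩
    · change rbar ((ψ.comp ρ) q) ≠ 0
      rw [hq, Ideal.Quotient.lift_mk, Ne, hr_zero]
      exact fun hlt => (lt_irrefl (1 : _)) (hvw ▸ hlt)
    · change residue O z' * rbar ((ψ.comp ρ) q) = rbar ((ψ.comp ρ) p)
      rw [hq, hp, Ideal.Quotient.lift_mk, Ideal.Quotient.lift_mk]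
      change residue O z' * residue O (incl ⟨w, hw⟩) = residue O (incl ⟨y, hy⟩)
      rw [← map_mul]
      congr 1
      apply Subtype.ext
      change (z' : K) * w = y
      rw [hzyw, div_mul_cancel₀ _ (ne_zero_of_valuation_eq_one hvw)]
  · intro s
    change rbar (ψ (ρ (MvPolynomial.C (residue S s)))) = _
    have hρC : ρ (MvPolynomial.C (residue S s)) = MvPolynomial.C (residue S s) :=
      MvPolynomial.rename_C _ _
    rw [hρC, hψC, Ideal.Quotient.lift_mk]
    rfl

end Exceptional

/-! ## Proved glue: the regular quadratic sequence exists at every step -/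

/-- The sequence `quadraticSeq O A` of a regular local ring `A ⊆ O` of `K`, not a field and
dominated by `O`, is an infinite sequence of quadratic transforms along `O` (each member is
regular, hence Noetherian, and not a field, so the next transform exists). -/
theorem isQuadraticTransformAlong_quadraticSeq_of_isRegularLocalRing {K : Type} [Field K]
    {O : ValuationSubring K} {A : Subring K} (hreg : IsRegularLocalRing A) (hA : ¬ IsField A)
    (h0 : SubringDominates A O.toSubring) (n : ℕ) :
    IsQuadraticTransformAlong O (quadraticSeq O A n) (quadraticSeq O A (n + 1)) := by
  -- invariant: `A_n` is regular local, contains `A`, and is dominated by `O`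
  have inv : ∀ n, ∃ _ : IsRegularLocalRing (quadraticSeq O A n), A ≤ quadraticSeq O A n ∧
      SubringDominates (quadraticSeq O A n) O.toSubring ∧
      IsQuadraticTransformAlong O (quadraticSeq O A n) (quadraticSeq O A (n + 1)) := by
    intro n
    induction n with
    | zero =>
      haveI : IsRegularLocalRing (quadraticSeq O A 0) := hreg
      refine ⟨‹_›, le_rfl, h0, ?_⟩
      exact quadraticSeq_succ_of_exists (exists_isQuadraticTransformAlong h0.1
        (maximalIdeal_ne_bot_of_subringDominates (B := quadraticSeq O A 0) hA h0 le_rfl h0.1))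
    | succ n ih =>
      obtain ⟨_, hAn, hdomn, hstepn⟩ := ih
      haveI : IsRegularLocalRing (quadraticSeq O A (n + 1)) :=
        hstepn.isRegularLocalRing_of_isRegularLocalRing ‹_›
      haveI : IsLocalRing A := hreg.toIsLocalRing
      have hA1 : A ≤ quadraticSeq O A (n + 1) := hAn.trans hstepn.le
      have hdom1 : SubringDominates (quadraticSeq O A (n + 1)) O.toSubring := hstepn.dominated
      refine ⟨‹_›, hA1, hdom1, ?_⟩
      exact quadraticSeq_succ_of_exists (exists_isQuadraticTransformAlong hdom1.1
        (maximalIdeal_ne_bot_of_subringDominates hA h0 hA1 hdom1.1))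
  exact (inv n).2.2.2

/-! ## The composition -/

/-- **THE CRUX** `RuledResidues.RegularModelRuled` (Abhyankar's ruledness), PROVED: from `dvrReach`,
`penultimate`, `exceptionalResidue`, `ratFuncRuled` and the glue below. -/
theorem RegularModelRuled_of :
    Summit.ResolutionOfSingularities.ResolutionOfSingularities.Theses.RuledResidues.RegularModelRuled := by
  intro k K _ _ _ W hk hdvr hdiv A hAfg hAfr h hregP hdimP
  classical
  -- the starting ring `R₀ = A_P ⊆ K`
  set R₀ : Subring K := locAtCentre A.toSubring W with hR₀
  have hAR₀ : A.toSubring ≤ R₀ := le_locAtCentre _ W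
  haveI hreg₀ : IsRegularLocalRing R₀ := (isRegularLocalRing_locAtCentre_iff h).mpr hregP
  have hdim₀ : (2 : WithBot ℕ∞) ≤ ringKrullDim R₀ := by
    rw [← ringKrullDim_eq_of_ringEquiv (locAtCentreEquiv h).toRingEquiv]
    exact hdimP
  have hof₀ : IsLocalRingOf R₀ := by
    refine ⟨isLocalRing_locAtCentre h, fun z => ?_⟩
    obtain ⟨a, b, hb, rfl⟩ := IsFractionRing.div_surjective (A := A) z
    refine ⟨a, hAR₀ a.2, b, hAR₀ b.2, ?_, rfl⟩
    have hb0 : b ≠ 0 := nonZeroDivisors.ne_zero hb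
    exact fun h0 => hb0 (Subtype.ext h0)
  have hnf₀ : ¬ IsField R₀ := by
    intro hF
    have h0 := ringKrullDim_eq_zero_of_isField hF
    rw [h0] at hdim₀
    exact absurd hdim₀ (by decide)
  have hdom₀ : SubringDominates R₀ W.toSubring := subringDominates_locAtCentre h
  -- the sequence of quadratic transforms of `R₀` along `W`
  set R : ℕ → Subring K := quadraticSeq W R₀ with hRdef
  have hR0 : R 0 = R₀ := rfl
  have hstep : ∀ i, IsQuadraticTransformAlong W (R i) (R (i + 1)) :=
    isQuadraticTransformAlong_quadraticSeq_of_isRegularLocalRing hreg₀ hnf₀ hdom₀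
  -- it reaches `W`: the divisorial model `B` is finitely generated
  haveI := hdvr
  obtain ⟨B, hBfg, hBW, hloc⟩ := hdiv
  obtain ⟨S, hSB⟩ := hBfg
  have hkR₀ : Set.range (algebraMap k K) ⊆ (R₀ : Set K) := by
    rintro _ ⟨c, rfl⟩
    exact hAR₀ (algebraMap k A c).2
  have hBN : B.toSubring ≤ Subring.closure ((R₀ : Set K) ∪ ↑S) := by
    rw [← hSB, Algebra.adjoin_eq_ring_closure]
    exact Subring.closure_mono (Set.union_subset_union_left _ hkR₀)
  have hSBset : (S : Set K) ⊆ B := by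
    rw [← hSB]
    exact Algebra.subset_adjoin
  have hNO : Subring.closure ((R₀ : Set K) ∪ ↑S) ≤ W.toSubring :=
    Subring.closure_le.mpr (Set.union_subset hdom₀.1 (hSBset.trans hBW))
  have hON : W.toSubring ≤ locAtCentre (Subring.closure ((R₀ : Set K) ∪ ↑S)) W := by
    intro x hx
    obtain ⟨b, s, hb, hs, hsW, hxs⟩ := hloc x hx
    have hvs : W.valuation s = 1 := valuation_eq_one_of_notMem_nonunits W (hBW hs) hsW
    refine ⟨b, hBN hb, s, hBN hs, hvs, ?_⟩
    rw [← hxs, mul_div_cancel_right₀ _ (ne_zero_of_notMem_nonunits W hsW)]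
  obtain ⟨c, hc⟩ := dvrReach W R hof₀ hdom₀ hstep hNO S
    (fun z hz => Subring.subset_closure (Or.inr hz)) le_rfl hON
  -- the penultimate ring `R_n`: regular of dimension `≥ 2`, with `R_{n+1} = W`
  obtain ⟨n, hregn, hdimn, hn⟩ := penultimate W R hreg₀ hdim₀ hof₀ hdom₀ hstep ⟨c, hc⟩
  have hS : IsQuadraticTransformAlong W (R n) W.toSubring := hn ▸ hstep n
  -- the residue field of `W` is `Frac κ(R_n)[X₁, …, X_c]`, `c ≥ 1`, hence ruled
  have hdomn : SubringDominates (R n) W.toSubring := (sequence_dominates hdom₀ hstep n).1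
  obtain ⟨d, hd, ι, hinj, hfrac, hcomp⟩ := exceptionalResidue W (R n) hregn hdimn hdomn hS
  obtain ⟨L, t, hL, htr, hgen⟩ :=
    ratFuncRuled (ResidueField (R n)) (ResidueField W) d hd ι hinj hfrac
  refine ⟨L, t, fun a => ?_, htr, hgen⟩
  -- `k ⊆ A ⊆ R₀ ⊆ R_n`, and the residue of a constant is a constant
  have hmono : Monotone R := sequence_monotone hstep
  have haRn : algebraMap k K a ∈ R n := hmono (Nat.zero_le n) (hAR₀ (algebraMap k A a).2)
  have key := hcomp ⟨algebraMap k K a, haRn⟩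
  have hmem := hL (residue (R n) ⟨algebraMap k K a, haRn⟩)
  rw [key] at hmem
  convert hmem using 2

end

end Summit.ResolutionOfSingularities.ResolutionOfSingularities.Cruxes.RegularModelRuled.DvrDescent
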